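import Summits.QuantumAdvantage.QuantumAdvantage.Theses.ThirdFactorialPincer
import Summits.QuantumAdvantage.QuantumAdvantage.Theorems.LinnikCubicClassGroupsDegreeOnePrimesEscapeCubicEscape
import Summits.QuantumAdvantage.QuantumAdvantage.Theorems.LinnikCubicClassGroupsDegreeOnePrimesEscapeResidueStarkLemma
import Summits.QuantumAdvantage.QuantumAdvantage.Theorems.LinnikCubicClassGroupsDegreeOnePrimesEscapePerCharacterDeficitLocal
import Summits.QuantumAdvantage.QuantumAdvantage.Theorems.LinnikCubicClassGroupsDegreeOnePrimesEscapeLowerPIT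
import Literature.NumberTheory.LFunctions.ClassGroupLogFreeTheorem14AllDegrees
import Literature.NumberTheory.LFunctions.DedekindZeta1LogFreeTheorem14AllDegrees
import HarnessLib

/-!
# The Linnik–Stark escape count from a real-zero-free interval ALONE (every degree, unconditional),
# and the crux `SexticEscapeCount` reduced to a classical zero-free interval

Topic `Summits/QuantumAdvantage/QuantumAdvantage/Theorems`; helper for the crux `SexticEscapeCount`
(stmt-QuantumAdvantage-14545) of route `ThirdFactorialPincer`, built from the toolkit of cell B2b-1
(linnik-cubic, crux `DegreeOnePrimesEscape`, routes `LinnikCubicClassGroups` / `ThirdFactorialPincer`).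
HONEST FRAMING: the value of this file is a THEOREM (kernel-checked, GRH-free, Siegel-free, free of
every named fact) — not summit progress.

* `DegreeOnePrimesEscape.escape_of_zeroFree` — **for every degree `n ≥ 3` and every `c > 0` there is
  `C = C(n, c)` such that for every number field `K` of degree `n` whose Dedekind zeta function has no
  REAL zero in `[1 − c/log|d_K|, 1)`, every `x ≥ |d_K|^C` and every proper subgroup `M` of `Cl(𝓞 K)`:
  `π(x) ≤ 8 · #{P : N P prime ≤ x, [P] ∉ M}`.** No hypothesis on quadratic subfields: the only input
  about `K` is the zero-free interval. Ingredients, all tree theorems with standard axioms: the log-free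
  zero-density estimates in every degree for the class-group twists and for `ζ₁_K`
  (`logFreeDensity_classGroup_all`, `logFreeDensity_dedekindZeta₁_all`; Weiss 1983 Thm 4.3 /
  Thorner–Zaman 2019 Thm 3.2 without the Deuring–Heilbronn factor), the degree-local one-sided
  per-character deficit T4 (`perCharacterDeficit_of_density_local`) and lower prime ideal theorem
  dichotomy T5 (`lowerPIT_of_density_local`), Stark's Lemma 4 (`Residue.residue_ge_of_zeroFree`:
  the zero-free interval gives `κ_K ≥ e^{−7}16^{−n}c/log|d_K| ≥ Q^{−(8 + 1/c)}`), and the per-field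
  composition `CubicEscape.escape_of_inputs` (the interval kills T5's nearby-zero alternative; subgroup
  orthogonality). `DegreeOnePrimesEscape` itself is the case where the interval comes from Stark's
  theorem for fields without quadratic subfield.
* `SexticEscapeCount.sexticEscapeCount_of_zeroFree` — the crux
  `Theses.ThirdFactorialPincer.SexticEscapeCount` BY NAME from ONE classical statement: a uniform
  `c > 0` such that `ζ_F(σ) ≠ 0` for `1 − c/log|d_F| ≤ σ < 1`, for every abelian sextic number field
  `F` of discriminant `−27p⁴`, `p ≡ 1 (3)` prime (`F = K_p(ω)`; on paper:
  `ζ_F = ζ · L(χ₋₃) · |L(χ_p)|² · |L(χ_p χ₋₃)|²`, the complex characters have no exceptional zero and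
  `L(σ, χ₋₃) > 0`). This replaces the named fact `ThornerZaman2019_classPNT_hilbertClassField`
  (Thorner–Zaman 2019 Thm 1.4, with Deuring–Heilbronn) in that crux's paper proof by proved theorems;
  what remains of the crux is the displayed zero-free interval (identification of the quadratic
  subfield `ℚ(√−3)` from `d_F = −27p⁴` plus the real-line zero-free region of four Dirichlet
  `L`-functions).
-/

noncomputable section

open scoped NumberField nonZeroDivisors
open Literature.NumberTheory.LFunctions Literature.NumberTheory.LFunctions.NumberField

namespace Summit.QuantumAdvantage.QuantumAdvantage.Theorems.DegreeOnePrimesEscape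

/-! ### The residue bound from a zero-free interval, in `Q`-power form -/

/-- **`κ_K ≥ Q^{−(8 + 1/c)}` from a real-zero-free interval `[1 − c/log|d_K|, 1)`, `0 < c ≤ ¼`**
(`Q = |d_K| n^n`): Stark's Lemma 4 (`Residue.residue_ge_of_zeroFree`:
`κ_K ≥ e^{−7} 16^{−n} c/log|d_K|`) and `e⁷ ≤ Q³`, `16ⁿ ≤ Q⁴`, `log|d_K| ≤ Q`, `1/c ≤ 12^{1/c} ≤ Q^{1/c}`.
[cite: Stark1974, Lemma 4] -/
theorem condQn_rpow_neg_le_residue_of_zeroFree (K : Type) [Field K] [NumberField K]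
    (hn : 1 < Module.finrank ℚ K) {c : ℝ} (hc : 0 < c) (hc4 : c ≤ 1 / 4)
    (hZ : ∀ σ : ℝ, 1 - c / Real.log ((NumberField.discr K).natAbs : ℝ) ≤ σ → σ < 1 →
      dedekindZetaCont K σ ≠ 0) :
    ThornerZaman.condQn K ^ (-(8 + 1 / c)) ≤ NumberField.dedekindZeta_residue K := by
  set n : ℕ := Module.finrank ℚ K with hndef
  set d : ℝ := ((NumberField.discr K).natAbs : ℝ) with hd
  set Q : ℝ := ThornerZaman.condQn K with hQ
  have hQ12 : (12 : ℝ) ≤ Q := ThornerZaman.twelve_le_condQn (K := K) hn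
  have hQ1 : (1 : ℝ) ≤ Q := by linarith
  have hQ0 : (0 : ℝ) < Q := by linarith
  have hd3 : (3 : ℝ) ≤ d := by
    have h2 := NumberField.abs_discr_gt_two hn
    rw [hd, Nat.cast_natAbs]
    exact_mod_cast (show (3 : ℤ) ≤ |NumberField.discr K| by omega)
  have hmain := Residue.residue_ge_of_zeroFree K hn hc hc4 hZ
  rw [← hndef] at hmain
  refine le_trans ?_ hmain
  have hlogd0 : 0 < Real.log d := Real.log_pos (by linarith)
  have hlogd : Real.log d ≤ Q := by
    have h1 : Real.log d ≤ d := (Real.log_le_sub_one_of_pos (by linarith)).trans (by linarith)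
    have h2 : d ≤ Q := by
      rw [hQ, ThornerZaman.condQn, hd, Nat.cast_natAbs, Int.cast_abs]
      have hn1 : (1 : ℝ) ≤ (Module.finrank ℚ K : ℝ) ^ Module.finrank ℚ K := by
        have : (1 : ℝ) ≤ Module.finrank ℚ K := by exact_mod_cast Module.finrank_pos (R := ℚ) (M := K)
        exact one_le_pow₀ this
      nlinarith [abs_nonneg ((NumberField.discr K : ℝ))]
    linarith
  have h16 : (16 : ℝ) ^ n ≤ Q ^ 4 := by
    have h2n : (2 : ℝ) ^ n ≤ Q := by
      have h1 : (2 : ℝ) ^ n ≤ (n : ℝ) ^ n := pow_le_pow_left₀ (by norm_num) (by exact_mod_cast hn) n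
      have h2 : (n : ℝ) ^ n ≤ Q := by
        rw [hQ, ThornerZaman.condQn, ← hndef]
        have hd1 : (1 : ℝ) ≤ |(NumberField.discr K : ℝ)| := by
          rw [← Int.cast_abs]; exact_mod_cast Int.one_le_abs (NumberField.discr_ne_zero K)
        have hnn : (0 : ℝ) ≤ (n : ℝ) ^ n := by positivity
        nlinarith
      linarith
    calc (16 : ℝ) ^ n = (2 ^ n) ^ 4 := by
          rw [← pow_mul, show (16 : ℝ) = 2 ^ 4 by norm_num, ← pow_mul, mul_comm]
      _ ≤ Q ^ 4 := pow_le_pow_left₀ (by positivity) h2n 4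
  have he7 : Real.exp 7 ≤ Q ^ 3 := by
    have h1 : Real.exp 7 < 1728 := by
      have := Real.exp_one_lt_d9
      have h7 : Real.exp 7 = Real.exp 1 ^ 7 := by rw [← Real.exp_nat_mul]; norm_num
      rw [h7]
      have : Real.exp 1 ^ 7 < 2.7182818286 ^ 7 :=
        pow_lt_pow_left₀ this (Real.exp_pos _).le (by norm_num)
      linarith [show (2.7182818286 : ℝ) ^ 7 < 1728 by norm_num]
    have h2 : (1728 : ℝ) ≤ Q ^ 3 := by
      have := pow_le_pow_left₀ (by norm_num) hQ12 3
      norm_num at this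
      exact this
    linarith
  -- `1/c ≤ Q^{1/c}`: `y ≤ 12^y ≤ Q^y` for `y = 1/c ≥ 0`
  have hinvc : 1 / c ≤ Q ^ (1 / c) := by
    have hy : (0 : ℝ) ≤ 1 / c := by positivity
    have h1 : 1 / c ≤ Real.exp (1 / c) := by
      have := Real.add_one_le_exp (1 / c); linarith
    have h2 : Real.exp (1 / c) ≤ (12 : ℝ) ^ (1 / c) := by
      rw [Real.rpow_def_of_pos (by norm_num : (0:ℝ) < 12)]
      apply Real.exp_le_exp.mpr
      have hl : (1 : ℝ) ≤ Real.log 12 := by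
        rw [Real.le_log_iff_exp_le (by norm_num)]
        have := Real.exp_one_lt_d9; linarith
      nlinarith
    have h3 : (12 : ℝ) ^ (1 / c) ≤ Q ^ (1 / c) := Real.rpow_le_rpow (by norm_num) hQ12 hy
    linarith
  -- assemble
  have hprod : Real.exp 7 * 16 ^ n * (1 / c) * Real.log d ≤ Q ^ (8 : ℝ) * Q ^ (1 / c) := by
    have h8 : Q ^ (8 : ℝ) = Q ^ 3 * Q ^ 4 * Q := by
      rw [show (8 : ℝ) = ((8 : ℕ) : ℝ) by norm_num, Real.rpow_natCast]; ring
    rw [h8]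
    calc Real.exp 7 * 16 ^ n * (1 / c) * Real.log d
        = (Real.exp 7 * 16 ^ n * Real.log d) * (1 / c) := by ring
      _ ≤ (Q ^ 3 * Q ^ 4 * Q) * Q ^ (1 / c) := by
          apply mul_le_mul _ hinvc (by positivity) (by positivity)
          exact mul_le_mul (mul_le_mul he7 h16 (by positivity) (by positivity)) hlogd hlogd0.le
            (by positivity)
  have hpos : 0 < Real.exp 7 * 16 ^ n * (1 / c) * Real.log d := by positivity
  have hD : Real.exp (-7) * (1 / 16 : ℝ) ^ n * (c / Real.log d) =
      (Real.exp 7 * 16 ^ n * (1 / c) * Real.log d)⁻¹ := by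
    rw [Real.exp_neg]
    field_simp
    rw [← mul_pow]; norm_num
  rw [Real.rpow_neg hQ0.le, Real.rpow_add hQ0, hD]
  exact inv_anti₀ hpos hprod

/-! ### The escape count from a zero-free interval alone -/

open scoped Classical in
/-- **The Linnik–Stark escape count from a real-zero-free interval alone (every degree `n ≥ 3`,
unconditional).** For `n ≥ 3` and `c > 0` there is `C : ℕ` such that for every number field `K` of
degree `n` with `ζ_K(σ) ≠ 0` for all real `σ ∈ [1 − c/log|d_K|, 1)`, every `x ≥ |d_K|^C` and every
proper subgroup `M` of `Cl(𝓞 K)`: `π(x) ≤ 8 · #{P prime of 𝓞 K : N P prime, N P ≤ x, [P] ∉ M}`.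
Proof: shrink `c` to `c' = min(c, ¼)`; `κ_K ≥ Q^{−A}`, `A = 8 + 1/c'`
(`condQn_rpow_neg_le_residue_of_zeroFree`); T4(n) and T5(n) at this `A` from the all-degree log-free
densities (`perCharacterDeficit_of_density_local`, `lowerPIT_of_density_local`,
`logFreeDensity_classGroup_all`, `logFreeDensity_dedekindZeta₁_all`); then `CubicEscape.escape_of_inputs`. -/
theorem escape_of_zeroFree (n : ℕ) (hn3 : 3 ≤ n) (c : ℝ) (hc : 0 < c) :
    ∃ C : ℕ, ∀ (K : Type) [Field K] [NumberField K], Module.finrank ℚ K = n →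
      (∀ σ : ℝ, 1 - c / Real.log ((NumberField.discr K).natAbs : ℝ) ≤ σ → σ < 1 →
        dedekindZetaCont K σ ≠ 0) →
      ∀ x : ℕ, |NumberField.discr K| ^ C ≤ (x : ℤ) →
      ∀ M : Subgroup (ClassGroup (𝓞 K)), M ≠ ⊤ →
        Nat.primeCounting x ≤ 8 * Set.ncard {P : Ideal (𝓞 K) | P.IsPrime ∧
          (Ideal.absNorm P).Prime ∧ Ideal.absNorm P ≤ x ∧
          ∃ hP : P ∈ nonZeroDivisors (Ideal (𝓞 K)), ClassGroup.mk0 ⟨P, hP⟩ ∉ M} := by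
  have h1n : 1 < n := by omega
  set c' : ℝ := min c (1 / 4) with hc'def
  have hc'0 : 0 < c' := lt_min hc (by norm_num)
  have hc'4 : c' ≤ 1 / 4 := min_le_right _ _
  have hc'c : c' ≤ c := min_le_left _ _
  set A : ℝ := 8 + 1 / c' with hAdef
  have hA : 0 ≤ A := by rw [hAdef]; positivity
  obtain ⟨C₂, hC₂⟩ := perCharacterDeficit_of_density_local n h1n (logFreeDensity_classGroup_all n) A hA
  obtain ⟨C₁, hC₁⟩ := lowerPIT_of_density_local n h1n A (logFreeDensity_dedekindZeta₁_all n)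
  refine ⟨(⌈max (max C₂ C₁) (max 1 (4 / c'))⌉₊ + 50) * (1 + n ^ 2) + n, ?_⟩
  intro K _ _ hKn hZ x hx M hM
  have hK : 1 < Module.finrank ℚ K := by rw [hKn]; exact h1n
  -- the interval with the smaller constant `c'`
  have hZ' : ∀ σ : ℝ, 1 - c' / Real.log ((NumberField.discr K).natAbs : ℝ) ≤ σ → σ < 1 →
      dedekindZetaCont K σ ≠ 0 := by
    intro σ hσ hσ1
    refine hZ σ (le_trans ?_ hσ) hσ1
    have hd3 : (3 : ℝ) ≤ ((NumberField.discr K).natAbs : ℝ) := by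
      have h2 := NumberField.abs_discr_gt_two hK
      rw [Nat.cast_natAbs]
      exact_mod_cast (show (3 : ℤ) ≤ |NumberField.discr K| by omega)
    have hlog : 0 < Real.log ((NumberField.discr K).natAbs : ℝ) := Real.log_pos (by linarith)
    have := div_le_div_of_nonneg_right hc'c hlog.le
    linarith
  have hκ : ThornerZaman.condQn K ^ (-A) ≤ NumberField.dedekindZeta_residue K :=
    condQn_rpow_neg_le_residue_of_zeroFree K hK hc'0 hc'4 hZ'
  exact CubicEscape.escape_of_inputs hn3 hc'0 K hKn (fun χ hχ y hy => hC₂ K hKn hκ χ hχ y hy)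
    (fun y hy => hC₁ K hKn hκ y hy) hZ' x _ rfl hx M hM

end Summit.QuantumAdvantage.QuantumAdvantage.Theorems.DegreeOnePrimesEscape

/-! ### The crux `SexticEscapeCount` from the zero-free interval of the sextic fields -/

namespace Summit.QuantumAdvantage.QuantumAdvantage.Theorems.SexticEscapeCount

open Summit.QuantumAdvantage.QuantumAdvantage.Theorems.DegreeOnePrimesEscape

/-- **`SexticEscapeCount` (crux of route `ThirdFactorialPincer`, by name) from ONE classical input**:
a uniform `c > 0` such that the Dedekind zeta function of every abelian sextic number field `F` of
discriminant `−27p⁴` (`p ≡ 1 (3)` prime; `F = K_p(ω)`) has no real zero in `[1 − c/log|d_F|, 1)`.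
Given that, `escape_of_zeroFree 6 c` yields `C₆` with the escape inequality (constant `8 ≤ 32`) for
`x ≥ |d_F|^{C₆}`, and `|d_F|^{C₆} = (27p⁴)^{C₆} ≤ p^{6C₆}` because `p ≥ 7`. -/
theorem sexticEscapeCount_of_zeroFree
    (hZ : ∃ c : ℝ, 0 < c ∧ ∀ (p : ℕ) (F : Type) [Field F] [NumberField F], p.Prime → p % 3 = 1 →
      Module.finrank ℚ F = 6 → IsGalois ℚ F → (∀ σ τ : F ≃ₐ[ℚ] F, σ * τ = τ * σ) →
      NumberField.discr F = -(27 * (p : ℤ) ^ 4) →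
      ∀ σ : ℝ, 1 - c / Real.log ((NumberField.discr F).natAbs : ℝ) ≤ σ → σ < 1 →
        dedekindZetaCont F σ ≠ 0) :
    Summit.QuantumAdvantage.QuantumAdvantage.Theses.ThirdFactorialPincer.SexticEscapeCount := by
  obtain ⟨c, hc, hZ⟩ := hZ
  obtain ⟨C₆, hC₆⟩ := escape_of_zeroFree 6 (by norm_num) c hc
  unfold Summit.QuantumAdvantage.QuantumAdvantage.Theses.ThirdFactorialPincer.SexticEscapeCount
  refine ⟨6 * C₆, ?_⟩
  intro p F _ _ hp hp3 hF6 hGal hab hdisc x hx M hM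
  have hp7 : 7 ≤ p := by
    by_contra h
    push Not at h
    interval_cases p <;> first | omega | exact absurd hp (by norm_num)
  -- `|d_F|^{C₆} ≤ p^{6 C₆} ≤ x`
  have hdF : |NumberField.discr F| = 27 * (p : ℤ) ^ 4 := by
    rw [hdisc, abs_neg]; exact abs_of_nonneg (by positivity)
  have h27 : (27 : ℤ) * (p : ℤ) ^ 4 ≤ (p : ℤ) ^ 6 := by
    have hp7' : (7 : ℤ) ≤ p := by exact_mod_cast hp7
    have hp2 : (49 : ℤ) ≤ (p : ℤ) ^ 2 := by nlinarith
    have hp4 : (0 : ℤ) ≤ (p : ℤ) ^ 4 := by positivity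
    calc (27 : ℤ) * (p : ℤ) ^ 4 ≤ 49 * (p : ℤ) ^ 4 := by nlinarith
      _ ≤ (p : ℤ) ^ 2 * (p : ℤ) ^ 4 := mul_le_mul_of_nonneg_right hp2 hp4
      _ = (p : ℤ) ^ 6 := by ring
  have hx' : |NumberField.discr F| ^ C₆ ≤ (x : ℤ) := by
    rw [hdF]
    calc (27 * (p : ℤ) ^ 4) ^ C₆ ≤ ((p : ℤ) ^ 6) ^ C₆ := pow_le_pow_left₀ (by positivity) h27 C₆
      _ = ((p ^ (6 * C₆) : ℕ) : ℤ) := by push_cast; rw [pow_mul]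
      _ ≤ (x : ℤ) := by exact_mod_cast hx
  have hmain := hC₆ F hF6 (hZ p F hp hp3 hF6 hGal hab hdisc) x hx' M hM
  exact hmain.trans (Nat.mul_le_mul_right _ (by norm_num))

end Summit.QuantumAdvantage.QuantumAdvantage.Theorems.SexticEscapeCount

end
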